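import Summits.ABC.IUTFork.Conditional.AbcOfSGenuineMLinUniformBand
import Summits.ABC.IUTFork.Conditional.AbcOfSGenuineKTameRobustRows1
import Summits.ABC.IUTFork.Conditional.AbcOfSGenuineKTameRobustRows2
import Summits.ABC.IUTFork.Conditional.AbcOfSGenuineKTameRobustRows3
import HarnessLib

/-!
# M LINE: R-W table rows (block F3) DECIDED on the refuted side, UNIFORMLY IN `l`, by [LIN]-uniform BAND theorems — part 7 (M twins of `…LinUniformBandRows7`)
# (triples: 2 * 5 ^ 10 * 13 ^ 4 + 3 ^ 15 * 7 * 31 ^ 7 * 45817 = 11 ^ 8 * 109 ^ 2 * 3677 ^ 3, 5 ^ 4 * 19 ^ 13 * 103 + 2 ^ 13 * 13 ^ 9 * 29 * 2441 * 7673 ^ 2 = 3 ^ 19 * 11 ^ 4 * 463 ^ 5, 7 ^ 5 * 61 + 2 ^ 13 * 13 ^ 7 * 17 ^ 3 * 4229 ^ 3 = 3 ^ 13 * 5 ^ 8 * 11 ^ 3 * 53 * 73 ^ 2 * 89 ^ 2 * 103, 2 ^ 19 * 367 ^ 3 + 5 ^ 17 * 197 * 281 = 13 ^ 2 * 251 ^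 6)

PROOF-ONLY file (no `def`, no new `Prop`, no instance) of the abc-iut cell (D-0079 R-W numerics crew seat abc-iut-W-num-6, gen 2; row «W:F3-LINU-BANDS»).
TAKES NO SIDE on [IUTchIII] Cor. 3.12 or on any author. ONE THEOREM PER KNOWN abc TRIPLE, M LINE: this seat's band certificate form
`GenuineM.not_pilotKummerCompatHull_triple_of_linUniform_cert` (`AbcOfSGenuineMLinUniformBand`) of abc-iut-w5-d107's M-line e-free [LIN]-uniform decider p466242 is
instantiated with ONE deciding prime `p ∉ {2,3,5}` of the triple and a short chain of bands `B` (case split on `l ≤ ⌊(p^B(p−1)−1)/30⌋`); every integer side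
condition is a closed numeral checked by `norm_num`, the band membership by `omega`. Each theorem `…_frey<a>_p<p>_band {l} (hl : l.Prime) (hlo : L₀ ≤ l) (hhi : l ≤ L₁) [(hneP : l ≠ p)] (T) (u : FinitePlace ℚ) (hu : ratChar u = p)`
decides, for EVERY prime `l` in its range (not only the tabulated `l ≤ 397` of the R-W numerics lead's WINDOW-TABLE block F3 / TE30-CENSUS) and EVERY genuine
Θ-volume datum `T` over `(ratPoint (a/c), l)`, that the hull-level clause S_H at the summand-route M-level sharp setting of `T`'s OWN read-off ideles (pinned reading — the per-datum object of the M window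
binder of `abc_of_SH_v11M_window`) FAILS for every choice of the free context binders and Kummer datum. The `IsABCTriple` facts are the tree's (abc-iut-w5-d107 / W-ref lineages), BY NAME.
Machine list of the (triple, l) rows: HOME/abc-iut-W-num-6/bands/BAND-ROWS-M.tsv (K list BAND-ROWS.tsv). NOT claimed: admissibility / Szpiro-badness / (P6) of `(ratPoint (a/c), l)`,
non-emptiness of the datum type. HONEST SCOPE as in the parents: SHARP reading; per-label licence STRONGER than print; «refuted as typed» ≠ «refuted in print»;
nothing about the number-level Corollary; typed ≠ proved; instantiated ≠ endorsed. [cite: Mochizuki2012, IUTchIII Cor. 3.12 Step (xi-f) p. 184; IUTchIV Prop. 1.2 p. 10,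
Cor. 2.2 (ii) proof p. 44] [cite: MochizukiGenEll2010, Thm. 2.1 p. 11] [claim: Mochizuki2012, status: disputed] for every IUT sentence quoted.
-/

noncomputable section

open Set Function NumberField IsDedekindDomain

namespace Summit.ABC.IUTFork.Conditional

open Thm311 Thm311.Real Cor312 Cor312Vol Cor312Prov Literature.IUT.LogThetaLattice Literature.IUT.LogVolume
  Literature.IUT.HodgeTheaters Literature.IUT.LogVolume.ThetaData Literature.IUT.LogVolume.Cor22
open Literature.NumberTheory.NumberFields Literature.NumberTheory.GaloisRepresentations.Ultrametric
open Literature.NumberTheory.DiophantineGeometry Literature.NumberTheory.DiophantineGeometry.GenEll Summit.ABC.ABC.Theorems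

/-- **M LINE — R-W ROWS `pilotDataOfK:frey-557832031250-126612145087527382220763-126612145088085214252013:l` for EVERY prime `9 ≤ l ≤ 960` with `l ≠
31` — REFUTED side at the M setting, unconditionally, BY ONE BAND THEOREM** (M twin of
`GenuineK.not_pilotKummerCompatHull_chosen_frey557832031250_band`; deciding place `u` over `p = 31`) (block F3 of the R-W numerics lead's
WINDOW-TABLE: 74 tabulated Szpiro-bad admissible `l` of this triple, `11 ≤ l ≤ 397`): triple `2 * 5 ^ 10 * 13 ^ 4 + 3 ^ 15 * 7 * 31 ^ 7 * 45817 = 11 ^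
8 * 109 ^ 2 * 3677 ^ 3`; deciding prime `p = 31` (`31^7 ∣ abc`, `p ∤ 30`), bands `B = 1` for `l ≤ 30` (certificate `l₀ = 9`); `B = 2` for `l ≤ 960`
(certificate `l₀ = 27`); `l = 31` excluded on the M line (one place `u` over `p`; the K twin decides it by `p' = 11`): at the label `j = l⋆ = (l−1)/2`
the [LIN]-uniform test of p464182 holds throughout the band (quadratic certificate `LinUniformBand.test_of_cert`), so the hull-level clause S_H FAILS
at the summand-route M-level sharp setting of the OWN read-off ideles (pinned reading) of every genuine Θ-volume datum over `(ratPoint (a/c), l)` for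
every choice of the free context binders and Kummer datum. NOT claimed: admissibility / Szpiro-badness / (P6) / non-emptiness. [cite: Mochizuki2012,
IUTchIII Cor. 3.12 Step (xi-f) p. 184; IUTchIV Prop. 1.2 p. 10] [claim: Mochizuki2012, status: disputed] -/
theorem GenuineM.not_pilotKummerCompatHull_frey557832031250_p31_band {l : ℕ} (hl : l.Prime) (hlo : 9 ≤ l) (hhi : l ≤ 960) (hneP : l ≠ 31)
    (T : Cor22.ThetaVolumeDatumAt (ratPoint (((2 * 5 ^ 10 * 13 ^ 4 : ℕ) : ℚ) / (11 ^ 8 * 109 ^ 2 * 3677 ^ 3 : ℕ))) l) (u : FinitePlace ℚ) (hu : ratChar u = 31) :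
    letI := T.instFieldF; letI := T.instNumberFieldF; letI := T.instAlgebraF; letI := T.instFieldK
    letI := T.instNumberFieldK; letI := T.instAlgebraK; letI := T.instFieldFbar; letI := T.instAlgebraFbar
    letI := T.instAlgebraKFbar; letI := T.instIsElliptic
    ∀ (M : Type) [Field M] [NumberField M]
      (archPk : ∀ (j : (thetaIndexOfInitial T.D).Label) (vQ : (thetaIndexOfInitial T.D).VQ),
        Set ((logShellsOfInitialDH T.D (analyticLogvVal T.K)).Packet j vQ))
      (archSub : ∀ (j : (thetaIndexOfInitial T.D).Label) (v : (thetaIndexOfInitial T.D).V),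
        Set ((logShellsOfInitialDH T.D (analyticLogvVal T.K)).Packet j ((thetaIndexOfInitial T.D).over v)))
      (Ψ : ℤ → ∀ v : (thetaIndexOfInitial T.D).V, v ∈ (thetaIndexOfInitial T.D).Vbad →
        Set ((logShellsOfInitialDH T.D (analyticLogvVal T.K)).StarPacket v))
      (act : ℤ → ∀ v : (thetaIndexOfInitial T.D).V, v ∈ (thetaIndexOfInitial T.D).Vbad →
        (logShellsOfInitialDH T.D (analyticLogvVal T.K)).StarPacket v →
          Module.End ℚ ((logShellsOfInitialDH T.D (analyticLogvVal T.K)).StarPacket v))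
      (Mmod : ℤ → ∀ j : (thetaIndexOfInitial T.D).LabelStar, Set ((logShellsOfInitialDH T.D (analyticLogvVal T.K)).GlobalPacket j.1))
      (region : ℤ → ∀ j : (thetaIndexOfInitial T.D).LabelStar, FinDivisor M → ∀ vQ : (thetaIndexOfInitial T.D).VQ,
        Set ((logShellsOfInitialDH T.D (analyticLogvVal T.K)).Packet j.1 vQ))
      (frobAdm : ℤ → ℤ → ∀ (j : (thetaIndexOfInitial T.D).Label) (vQ : (thetaIndexOfInitial T.D).VQ),
        Set ((logShellsOfInitialDH T.D (analyticLogvVal T.K)).Packet j vQ) → Prop)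
      (frobLogvol : ℤ → ℤ → ∀ (j : (thetaIndexOfInitial T.D).Label) (vQ : (thetaIndexOfInitial T.D).VQ),
        Set ((logShellsOfInitialDH T.D (analyticLogvVal T.K)).Packet j vQ) → ℝ)
      (frobΨ : ℤ → ℤ → ∀ v : (thetaIndexOfInitial T.D).V, v ∈ (thetaIndexOfInitial T.D).Vbad →
        Set ((logShellsOfInitialDH T.D (analyticLogvVal T.K)).StarPacket v))
      (frobMmod : ℤ → ℤ → ∀ j : (thetaIndexOfInitial T.D).LabelStar, Set ((logShellsOfInitialDH T.D (analyticLogvVal T.K)).GlobalPacket j.1))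
      (unitImage : ℤ → ℤ → ℕ → ∀ (j : (thetaIndexOfInitial T.D).Label) (vQ : (thetaIndexOfInitial T.D).VQ),
        Set ((logShellsOfInitialDH T.D (analyticLogvVal T.K)).Packet j vQ))
      (ballImage : ℤ → ℤ → ∀ (j : (thetaIndexOfInitial T.D).Label) (vQ : (thetaIndexOfInitial T.D).VQ),
        Set ((logShellsOfInitialDH T.D (analyticLogvVal T.K)).Packet j vQ))
      (thetaDiv : ℤ → ℤ → LgpDivisor M (thetaIndexOfInitial T.D).lstar)
      (n : ℤ) {HT : Type} {LogLink : HT → HT → Type} {IsFull : ∀ {s t : HT}, LogLink s t → Prop}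
      (lat : LGPGaussianLogThetaLattice LogLink IsFull)
      {Frd : Type} {IsoF : Frd → Frd → Type} {Ob : Frd → Type} {realify : Frd → Frd} {Strip : Type}
      {IsoS : Strip → Strip → Type} {Mv : ∀ v : (thetaIndexOfInitial T.D).V, v ∈ (thetaIndexOfInitial T.D).Vbad → Type}
      [∀ v h, Monoid (Mv v h)]
      (sig : GlobalLGPFrobenioidSignature (thetaIndexOfInitial T.D).lstar (thetaIndexOfInitial T.D).V
        (· ∈ (thetaIndexOfInitial T.D).Vbad) Frd IsoF Ob realify Strip IsoS Mv)
      (split : SplittingMonoids Mv) {ObΔ : Type} {N : ∀ v : (thetaIndexOfInitial T.D).V, v ∈ (thetaIndexOfInitial T.D).Vbad → Type}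
      [∀ v h, Monoid (N v h)] (qData : QPilotData ObΔ N)
      (qK : ∀ v : (thetaIndexOfInitial T.D).V, v ∈ (thetaIndexOfInitial T.D).Vbad →
        Set ((logShellsOfInitialDH T.D (analyticLogvVal T.K)).StarPacket v)),
      ¬ Cor312Vol.PilotKummerCompatHull
        (LatticeSituation.ofShells (logShellsOfInitialDH T.D (analyticLogvVal T.K)) M archPk archSub
          (summandPiecesPrM T.D (logvAnalyticVal_analyticLogvVal (K := T.K))).Adm (summandPiecesPrM T.D (logvAnalyticVal_analyticLogvVal (K := T.K))).logvol Ψ act Mmod region frobAdm frobLogvol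
          frobΨ frobMmod unitImage ballImage thetaDiv)
        (settingPrVolSharpM T.D (logvAnalyticVal_analyticLogvVal (K := T.K)) (tOfIdeleData T.D (ideleDataOf T.D T.isVolumeInputOf))
          (fun u x => tqM T.D (ratChar u) u (natCast_ratChar_mem u) (ideleDataOf T.D T.isVolumeInputOf) x) M archPk archSub Ψ act Mmod region n lat sig split qData
          (fun u x => tqM_ne_zero T.D (ratChar u) u (natCast_ratChar_mem u) (ideleDataOf T.D T.isVolumeInputOf) x)
          (GenuineM.finite_ratPlaces_under_S T.D).toFinset
          (fun u x hu => norm_tqM_eq_one_of_not_mem T.D (ratChar u) u (natCast_ratChar_mem u) (ideleDataOf T.D T.isVolumeInputOf) x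
            fun hx => hu ((Set.Finite.mem_toFinset _).mpr ⟨x, hx⟩)))
        (fun _ => Cor312.Setting.qRegion
          (settingPrVolSharpM T.D (logvAnalyticVal_analyticLogvVal (K := T.K)) (tOfIdeleData T.D (ideleDataOf T.D T.isVolumeInputOf))
          (fun u x => tqM T.D (ratChar u) u (natCast_ratChar_mem u) (ideleDataOf T.D T.isVolumeInputOf) x) M archPk archSub Ψ act Mmod region n lat sig split qData
          (fun u x => tqM_ne_zero T.D (ratChar u) u (natCast_ratChar_mem u) (ideleDataOf T.D T.isVolumeInputOf) x)
          (GenuineM.finite_ratPlaces_under_S T.D).toFinset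
          (fun u x hu => norm_tqM_eq_one_of_not_mem T.D (ratChar u) u (natCast_ratChar_mem u) (ideleDataOf T.D T.isVolumeInputOf) x
            fun hx => hu ((Set.Finite.mem_toFinset _).mpr ⟨x, hx⟩)))) qK := by
  rcases Nat.lt_or_ge l 31 with hlt0 | hge0
  · exact GenuineM.not_pilotKummerCompatHull_triple_of_linUniform_cert isABCTriple_3677 T u 31 hu (by norm_num) (by norm_num)
      (by norm_num) hneP.symm 1 (by show 30 * l < 31 ^ 1 * (31 - 1); norm_num; omega) 7 (by norm_num) (dvd_mul_of_dvd_left (dvd_mul_of_dvd_right (by norm_num) _) _) hl (by omega) 9 (by omega)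
      (by norm_num) (by norm_num) (by norm_num)
  exact GenuineM.not_pilotKummerCompatHull_triple_of_linUniform_cert isABCTriple_3677 T u 31 hu (by norm_num) (by norm_num)
      (by norm_num) hneP.symm 2 (by show 30 * l < 31 ^ 2 * (31 - 1); norm_num; omega) 7 (by norm_num) (dvd_mul_of_dvd_left (dvd_mul_of_dvd_right (by norm_num) _) _) hl (by omega) 27 (by omega)
      (by norm_num) (by norm_num) (by norm_num)

/-- **M LINE — R-W ROWS `pilotDataOfK:frey-2707160810382798173125-362056449426413786635575296-362059156587224169433748421:l` for EVERY prime `5 ≤ l ≤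
1485659` with `l ≠ 19` — REFUTED side at the M setting, unconditionally, BY ONE BAND THEOREM** (M twin of
`GenuineK.not_pilotKummerCompatHull_chosen_frey2707160810382798173125_band`; deciding place `u` over `p = 19`) (block F3 of the R-W numerics lead's
WINDOW-TABLE: 73 tabulated Szpiro-bad admissible `l` of this triple, `7 ≤ l ≤ 397`): triple `5 ^ 4 * 19 ^ 13 * 103 + 2 ^ 13 * 13 ^ 9 * 29 * 2441 *
7673 ^ 2 = 3 ^ 19 * 11 ^ 4 * 463 ^ 5`; deciding prime `p = 19` (`19^13 ∣ abc`, `p ∤ 30`), bands `B = 1` for `l ≤ 11` (certificate `l₀ = 5`); `B = 2`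
for `l ≤ 216` (certificate `l₀ = 7`); `B = 3` for `l ≤ 4115` (certificate `l₀ = 9`); `B = 4` for `l ≤ 78192` (certificate `l₀ = 15`); `B = 5` for `l ≤
1485659` (certificate `l₀ = 49`); `l = 19` excluded on the M line (one place `u` over `p`; the K twin decides it by `p' = 13`): at the label `j = l⋆ =
(l−1)/2` the [LIN]-uniform test of p464182 holds throughout the band (quadratic certificate `LinUniformBand.test_of_cert`), so the hull-level clause
S_H FAILS at the summand-route M-level sharp setting of the OWN read-off ideles (pinned reading) of every genuine Θ-volume datum over `(ratPoint
(a/c), l)` for every choice of the free context binders and Kummer datum. NOT claimed: admissibility / Szpiro-badness / (P6) / non-emptiness. [cite: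
Mochizuki2012, IUTchIII Cor. 3.12 Step (xi-f) p. 184; IUTchIV Prop. 1.2 p. 10] [claim: Mochizuki2012, status: disputed] -/
theorem GenuineM.not_pilotKummerCompatHull_frey2707160810382798173125_p19_band {l : ℕ} (hl : l.Prime) (hlo : 5 ≤ l) (hhi : l ≤ 1485659) (hneP : l ≠ 19)
    (T : Cor22.ThetaVolumeDatumAt (ratPoint (((5 ^ 4 * 19 ^ 13 * 103 : ℕ) : ℚ) / (3 ^ 19 * 11 ^ 4 * 463 ^ 5 : ℕ))) l) (u : FinitePlace ℚ) (hu : ratChar u = 19) :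
    letI := T.instFieldF; letI := T.instNumberFieldF; letI := T.instAlgebraF; letI := T.instFieldK
    letI := T.instNumberFieldK; letI := T.instAlgebraK; letI := T.instFieldFbar; letI := T.instAlgebraFbar
    letI := T.instAlgebraKFbar; letI := T.instIsElliptic
    ∀ (M : Type) [Field M] [NumberField M]
      (archPk : ∀ (j : (thetaIndexOfInitial T.D).Label) (vQ : (thetaIndexOfInitial T.D).VQ),
        Set ((logShellsOfInitialDH T.D (analyticLogvVal T.K)).Packet j vQ))
      (archSub : ∀ (j : (thetaIndexOfInitial T.D).Label) (v : (thetaIndexOfInitial T.D).V),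
        Set ((logShellsOfInitialDH T.D (analyticLogvVal T.K)).Packet j ((thetaIndexOfInitial T.D).over v)))
      (Ψ : ℤ → ∀ v : (thetaIndexOfInitial T.D).V, v ∈ (thetaIndexOfInitial T.D).Vbad →
        Set ((logShellsOfInitialDH T.D (analyticLogvVal T.K)).StarPacket v))
      (act : ℤ → ∀ v : (thetaIndexOfInitial T.D).V, v ∈ (thetaIndexOfInitial T.D).Vbad →
        (logShellsOfInitialDH T.D (analyticLogvVal T.K)).StarPacket v →
          Module.End ℚ ((logShellsOfInitialDH T.D (analyticLogvVal T.K)).StarPacket v))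
      (Mmod : ℤ → ∀ j : (thetaIndexOfInitial T.D).LabelStar, Set ((logShellsOfInitialDH T.D (analyticLogvVal T.K)).GlobalPacket j.1))
      (region : ℤ → ∀ j : (thetaIndexOfInitial T.D).LabelStar, FinDivisor M → ∀ vQ : (thetaIndexOfInitial T.D).VQ,
        Set ((logShellsOfInitialDH T.D (analyticLogvVal T.K)).Packet j.1 vQ))
      (frobAdm : ℤ → ℤ → ∀ (j : (thetaIndexOfInitial T.D).Label) (vQ : (thetaIndexOfInitial T.D).VQ),
        Set ((logShellsOfInitialDH T.D (analyticLogvVal T.K)).Packet j vQ) → Prop)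
      (frobLogvol : ℤ → ℤ → ∀ (j : (thetaIndexOfInitial T.D).Label) (vQ : (thetaIndexOfInitial T.D).VQ),
        Set ((logShellsOfInitialDH T.D (analyticLogvVal T.K)).Packet j vQ) → ℝ)
      (frobΨ : ℤ → ℤ → ∀ v : (thetaIndexOfInitial T.D).V, v ∈ (thetaIndexOfInitial T.D).Vbad →
        Set ((logShellsOfInitialDH T.D (analyticLogvVal T.K)).StarPacket v))
      (frobMmod : ℤ → ℤ → ∀ j : (thetaIndexOfInitial T.D).LabelStar, Set ((logShellsOfInitialDH T.D (analyticLogvVal T.K)).GlobalPacket j.1))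
      (unitImage : ℤ → ℤ → ℕ → ∀ (j : (thetaIndexOfInitial T.D).Label) (vQ : (thetaIndexOfInitial T.D).VQ),
        Set ((logShellsOfInitialDH T.D (analyticLogvVal T.K)).Packet j vQ))
      (ballImage : ℤ → ℤ → ∀ (j : (thetaIndexOfInitial T.D).Label) (vQ : (thetaIndexOfInitial T.D).VQ),
        Set ((logShellsOfInitialDH T.D (analyticLogvVal T.K)).Packet j vQ))
      (thetaDiv : ℤ → ℤ → LgpDivisor M (thetaIndexOfInitial T.D).lstar)
      (n : ℤ) {HT : Type} {LogLink : HT → HT → Type} {IsFull : ∀ {s t : HT}, LogLink s t → Prop}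
      (lat : LGPGaussianLogThetaLattice LogLink IsFull)
      {Frd : Type} {IsoF : Frd → Frd → Type} {Ob : Frd → Type} {realify : Frd → Frd} {Strip : Type}
      {IsoS : Strip → Strip → Type} {Mv : ∀ v : (thetaIndexOfInitial T.D).V, v ∈ (thetaIndexOfInitial T.D).Vbad → Type}
      [∀ v h, Monoid (Mv v h)]
      (sig : GlobalLGPFrobenioidSignature (thetaIndexOfInitial T.D).lstar (thetaIndexOfInitial T.D).V
        (· ∈ (thetaIndexOfInitial T.D).Vbad) Frd IsoF Ob realify Strip IsoS Mv)
      (split : SplittingMonoids Mv) {ObΔ : Type} {N : ∀ v : (thetaIndexOfInitial T.D).V, v ∈ (thetaIndexOfInitial T.D).Vbad → Type}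
      [∀ v h, Monoid (N v h)] (qData : QPilotData ObΔ N)
      (qK : ∀ v : (thetaIndexOfInitial T.D).V, v ∈ (thetaIndexOfInitial T.D).Vbad →
        Set ((logShellsOfInitialDH T.D (analyticLogvVal T.K)).StarPacket v)),
      ¬ Cor312Vol.PilotKummerCompatHull
        (LatticeSituation.ofShells (logShellsOfInitialDH T.D (analyticLogvVal T.K)) M archPk archSub
          (summandPiecesPrM T.D (logvAnalyticVal_analyticLogvVal (K := T.K))).Adm (summandPiecesPrM T.D (logvAnalyticVal_analyticLogvVal (K := T.K))).logvol Ψ act Mmod region frobAdm frobLogvol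
          frobΨ frobMmod unitImage ballImage thetaDiv)
        (settingPrVolSharpM T.D (logvAnalyticVal_analyticLogvVal (K := T.K)) (tOfIdeleData T.D (ideleDataOf T.D T.isVolumeInputOf))
          (fun u x => tqM T.D (ratChar u) u (natCast_ratChar_mem u) (ideleDataOf T.D T.isVolumeInputOf) x) M archPk archSub Ψ act Mmod region n lat sig split qData
          (fun u x => tqM_ne_zero T.D (ratChar u) u (natCast_ratChar_mem u) (ideleDataOf T.D T.isVolumeInputOf) x)
          (GenuineM.finite_ratPlaces_under_S T.D).toFinset
          (fun u x hu => norm_tqM_eq_one_of_not_mem T.D (ratChar u) u (natCast_ratChar_mem u) (ideleDataOf T.D T.isVolumeInputOf) x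
            fun hx => hu ((Set.Finite.mem_toFinset _).mpr ⟨x, hx⟩)))
        (fun _ => Cor312.Setting.qRegion
          (settingPrVolSharpM T.D (logvAnalyticVal_analyticLogvVal (K := T.K)) (tOfIdeleData T.D (ideleDataOf T.D T.isVolumeInputOf))
          (fun u x => tqM T.D (ratChar u) u (natCast_ratChar_mem u) (ideleDataOf T.D T.isVolumeInputOf) x) M archPk archSub Ψ act Mmod region n lat sig split qData
          (fun u x => tqM_ne_zero T.D (ratChar u) u (natCast_ratChar_mem u) (ideleDataOf T.D T.isVolumeInputOf) x)
          (GenuineM.finite_ratPlaces_under_S T.D).toFinset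
          (fun u x hu => norm_tqM_eq_one_of_not_mem T.D (ratChar u) u (natCast_ratChar_mem u) (ideleDataOf T.D T.isVolumeInputOf) x
            fun hx => hu ((Set.Finite.mem_toFinset _).mpr ⟨x, hx⟩)))) qK := by
  rcases Nat.lt_or_ge l 12 with hlt0 | hge0
  · exact GenuineM.not_pilotKummerCompatHull_triple_of_linUniform_cert isABCTriple_463 T u 19 hu (by norm_num) (by norm_num)
      (by norm_num) hneP.symm 1 (by show 30 * l < 19 ^ 1 * (19 - 1); norm_num; omega) 13 (by norm_num) (dvd_mul_of_dvd_left (dvd_mul_of_dvd_left (by norm_num) _) _) hl (by omega) 5 (by omega)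
      (by norm_num) (by norm_num) (by norm_num)
  rcases Nat.lt_or_ge l 217 with hlt1 | hge1
  · exact GenuineM.not_pilotKummerCompatHull_triple_of_linUniform_cert isABCTriple_463 T u 19 hu (by norm_num) (by norm_num)
      (by norm_num) hneP.symm 2 (by show 30 * l < 19 ^ 2 * (19 - 1); norm_num; omega) 13 (by norm_num) (dvd_mul_of_dvd_left (dvd_mul_of_dvd_left (by norm_num) _) _) hl (by omega) 7 (by omega)
      (by norm_num) (by norm_num) (by norm_num)
  rcases Nat.lt_or_ge l 4116 with hlt2 | hge2
  · exact GenuineM.not_pilotKummerCompatHull_triple_of_linUniform_cert isABCTriple_463 T u 19 hu (by norm_num) (by norm_num)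
      (by norm_num) hneP.symm 3 (by show 30 * l < 19 ^ 3 * (19 - 1); norm_num; omega) 13 (by norm_num) (dvd_mul_of_dvd_left (dvd_mul_of_dvd_left (by norm_num) _) _) hl (by omega) 9 (by omega)
      (by norm_num) (by norm_num) (by norm_num)
  rcases Nat.lt_or_ge l 78193 with hlt3 | hge3
  · exact GenuineM.not_pilotKummerCompatHull_triple_of_linUniform_cert isABCTriple_463 T u 19 hu (by norm_num) (by norm_num)
      (by norm_num) hneP.symm 4 (by show 30 * l < 19 ^ 4 * (19 - 1); norm_num; omega) 13 (by norm_num) (dvd_mul_of_dvd_left (dvd_mul_of_dvd_left (by norm_num) _) _) hl (by omega) 15 (by omega)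
      (by norm_num) (by norm_num) (by norm_num)
  exact GenuineM.not_pilotKummerCompatHull_triple_of_linUniform_cert isABCTriple_463 T u 19 hu (by norm_num) (by norm_num)
      (by norm_num) hneP.symm 5 (by show 30 * l < 19 ^ 5 * (19 - 1); norm_num; omega) 13 (by norm_num) (dvd_mul_of_dvd_left (dvd_mul_of_dvd_left (by norm_num) _) _) hl (by omega) 49 (by omega)
      (by norm_num) (by norm_num) (by norm_num)

/-- **M LINE — R-W ROWS `pilotDataOfK:frey-1025227-191008735430507276015771648-191008735430507276016796875:l` for EVERY prime `31 ≤ l ≤ 67` — REFUTED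
side at the M setting, unconditionally, BY ONE BAND THEOREM** (M twin of `GenuineK.not_pilotKummerCompatHull_chosen_frey1025227_band`; deciding place
`u` over `p = 13`) (block F3 of the R-W numerics lead's WINDOW-TABLE: 2 tabulated Szpiro-bad admissible `l` of this triple, `53 ≤ l ≤ 61`): triple `7
^ 5 * 61 + 2 ^ 13 * 13 ^ 7 * 17 ^ 3 * 4229 ^ 3 = 3 ^ 13 * 5 ^ 8 * 11 ^ 3 * 53 * 73 ^ 2 * 89 ^ 2 * 103`; deciding prime `p = 13` (`13^7 ∣ abc`, `p ∤
30`), bands `B = 2` for `l ≤ 67` (certificate `l₀ = 31`): at the label `j = l⋆ = (l−1)/2` the [LIN]-uniform test of p464182 holds throughout the band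
(quadratic certificate `LinUniformBand.test_of_cert`), so the hull-level clause S_H FAILS at the summand-route M-level sharp setting of the OWN
read-off ideles (pinned reading) of every genuine Θ-volume datum over `(ratPoint (a/c), l)` for every choice of the free context binders and Kummer
datum. NOT claimed: admissibility / Szpiro-badness / (P6) / non-emptiness. [cite: Mochizuki2012, IUTchIII Cor. 3.12 Step (xi-f) p. 184; IUTchIV Prop.
1.2 p. 10] [claim: Mochizuki2012, status: disputed] -/
theorem GenuineM.not_pilotKummerCompatHull_frey1025227_p13_band {l : ℕ} (hl : l.Prime) (hlo : 31 ≤ l) (hhi : l ≤ 67)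
    (T : Cor22.ThetaVolumeDatumAt (ratPoint (((7 ^ 5 * 61 : ℕ) : ℚ) / (3 ^ 13 * 5 ^ 8 * 11 ^ 3 * 53 * 73 ^ 2 * 89 ^ 2 * 103 : ℕ))) l) (u : FinitePlace ℚ) (hu : ratChar u = 13) :
    letI := T.instFieldF; letI := T.instNumberFieldF; letI := T.instAlgebraF; letI := T.instFieldK
    letI := T.instNumberFieldK; letI := T.instAlgebraK; letI := T.instFieldFbar; letI := T.instAlgebraFbar
    letI := T.instAlgebraKFbar; letI := T.instIsElliptic
    ∀ (M : Type) [Field M] [NumberField M]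
      (archPk : ∀ (j : (thetaIndexOfInitial T.D).Label) (vQ : (thetaIndexOfInitial T.D).VQ),
        Set ((logShellsOfInitialDH T.D (analyticLogvVal T.K)).Packet j vQ))
      (archSub : ∀ (j : (thetaIndexOfInitial T.D).Label) (v : (thetaIndexOfInitial T.D).V),
        Set ((logShellsOfInitialDH T.D (analyticLogvVal T.K)).Packet j ((thetaIndexOfInitial T.D).over v)))
      (Ψ : ℤ → ∀ v : (thetaIndexOfInitial T.D).V, v ∈ (thetaIndexOfInitial T.D).Vbad →
        Set ((logShellsOfInitialDH T.D (analyticLogvVal T.K)).StarPacket v))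
      (act : ℤ → ∀ v : (thetaIndexOfInitial T.D).V, v ∈ (thetaIndexOfInitial T.D).Vbad →
        (logShellsOfInitialDH T.D (analyticLogvVal T.K)).StarPacket v →
          Module.End ℚ ((logShellsOfInitialDH T.D (analyticLogvVal T.K)).StarPacket v))
      (Mmod : ℤ → ∀ j : (thetaIndexOfInitial T.D).LabelStar, Set ((logShellsOfInitialDH T.D (analyticLogvVal T.K)).GlobalPacket j.1))
      (region : ℤ → ∀ j : (thetaIndexOfInitial T.D).LabelStar, FinDivisor M → ∀ vQ : (thetaIndexOfInitial T.D).VQ,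
        Set ((logShellsOfInitialDH T.D (analyticLogvVal T.K)).Packet j.1 vQ))
      (frobAdm : ℤ → ℤ → ∀ (j : (thetaIndexOfInitial T.D).Label) (vQ : (thetaIndexOfInitial T.D).VQ),
        Set ((logShellsOfInitialDH T.D (analyticLogvVal T.K)).Packet j vQ) → Prop)
      (frobLogvol : ℤ → ℤ → ∀ (j : (thetaIndexOfInitial T.D).Label) (vQ : (thetaIndexOfInitial T.D).VQ),
        Set ((logShellsOfInitialDH T.D (analyticLogvVal T.K)).Packet j vQ) → ℝ)
      (frobΨ : ℤ → ℤ → ∀ v : (thetaIndexOfInitial T.D).V, v ∈ (thetaIndexOfInitial T.D).Vbad →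
        Set ((logShellsOfInitialDH T.D (analyticLogvVal T.K)).StarPacket v))
      (frobMmod : ℤ → ℤ → ∀ j : (thetaIndexOfInitial T.D).LabelStar, Set ((logShellsOfInitialDH T.D (analyticLogvVal T.K)).GlobalPacket j.1))
      (unitImage : ℤ → ℤ → ℕ → ∀ (j : (thetaIndexOfInitial T.D).Label) (vQ : (thetaIndexOfInitial T.D).VQ),
        Set ((logShellsOfInitialDH T.D (analyticLogvVal T.K)).Packet j vQ))
      (ballImage : ℤ → ℤ → ∀ (j : (thetaIndexOfInitial T.D).Label) (vQ : (thetaIndexOfInitial T.D).VQ),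
        Set ((logShellsOfInitialDH T.D (analyticLogvVal T.K)).Packet j vQ))
      (thetaDiv : ℤ → ℤ → LgpDivisor M (thetaIndexOfInitial T.D).lstar)
      (n : ℤ) {HT : Type} {LogLink : HT → HT → Type} {IsFull : ∀ {s t : HT}, LogLink s t → Prop}
      (lat : LGPGaussianLogThetaLattice LogLink IsFull)
      {Frd : Type} {IsoF : Frd → Frd → Type} {Ob : Frd → Type} {realify : Frd → Frd} {Strip : Type}
      {IsoS : Strip → Strip → Type} {Mv : ∀ v : (thetaIndexOfInitial T.D).V, v ∈ (thetaIndexOfInitial T.D).Vbad → Type}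
      [∀ v h, Monoid (Mv v h)]
      (sig : GlobalLGPFrobenioidSignature (thetaIndexOfInitial T.D).lstar (thetaIndexOfInitial T.D).V
        (· ∈ (thetaIndexOfInitial T.D).Vbad) Frd IsoF Ob realify Strip IsoS Mv)
      (split : SplittingMonoids Mv) {ObΔ : Type} {N : ∀ v : (thetaIndexOfInitial T.D).V, v ∈ (thetaIndexOfInitial T.D).Vbad → Type}
      [∀ v h, Monoid (N v h)] (qData : QPilotData ObΔ N)
      (qK : ∀ v : (thetaIndexOfInitial T.D).V, v ∈ (thetaIndexOfInitial T.D).Vbad →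
        Set ((logShellsOfInitialDH T.D (analyticLogvVal T.K)).StarPacket v)),
      ¬ Cor312Vol.PilotKummerCompatHull
        (LatticeSituation.ofShells (logShellsOfInitialDH T.D (analyticLogvVal T.K)) M archPk archSub
          (summandPiecesPrM T.D (logvAnalyticVal_analyticLogvVal (K := T.K))).Adm (summandPiecesPrM T.D (logvAnalyticVal_analyticLogvVal (K := T.K))).logvol Ψ act Mmod region frobAdm frobLogvol
          frobΨ frobMmod unitImage ballImage thetaDiv)
        (settingPrVolSharpM T.D (logvAnalyticVal_analyticLogvVal (K := T.K)) (tOfIdeleData T.D (ideleDataOf T.D T.isVolumeInputOf))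
          (fun u x => tqM T.D (ratChar u) u (natCast_ratChar_mem u) (ideleDataOf T.D T.isVolumeInputOf) x) M archPk archSub Ψ act Mmod region n lat sig split qData
          (fun u x => tqM_ne_zero T.D (ratChar u) u (natCast_ratChar_mem u) (ideleDataOf T.D T.isVolumeInputOf) x)
          (GenuineM.finite_ratPlaces_under_S T.D).toFinset
          (fun u x hu => norm_tqM_eq_one_of_not_mem T.D (ratChar u) u (natCast_ratChar_mem u) (ideleDataOf T.D T.isVolumeInputOf) x
            fun hx => hu ((Set.Finite.mem_toFinset _).mpr ⟨x, hx⟩)))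
        (fun _ => Cor312.Setting.qRegion
          (settingPrVolSharpM T.D (logvAnalyticVal_analyticLogvVal (K := T.K)) (tOfIdeleData T.D (ideleDataOf T.D T.isVolumeInputOf))
          (fun u x => tqM T.D (ratChar u) u (natCast_ratChar_mem u) (ideleDataOf T.D T.isVolumeInputOf) x) M archPk archSub Ψ act Mmod region n lat sig split qData
          (fun u x => tqM_ne_zero T.D (ratChar u) u (natCast_ratChar_mem u) (ideleDataOf T.D T.isVolumeInputOf) x)
          (GenuineM.finite_ratPlaces_under_S T.D).toFinset
          (fun u x hu => norm_tqM_eq_one_of_not_mem T.D (ratChar u) u (natCast_ratChar_mem u) (ideleDataOf T.D T.isVolumeInputOf) x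
            fun hx => hu ((Set.Finite.mem_toFinset _).mpr ⟨x, hx⟩)))) qK := by
  have hneP : l ≠ 13 := by omega
  exact GenuineM.not_pilotKummerCompatHull_triple_of_linUniform_cert isABCTriple_4229 T u 13 hu (by norm_num) (by norm_num)
      (by norm_num) hneP.symm 2 (by show 30 * l < 13 ^ 2 * (13 - 1); norm_num; omega) 7 (by norm_num) (dvd_mul_of_dvd_left (dvd_mul_of_dvd_right (by norm_num) _) _) hl (by omega) 31 (by omega)
      (by norm_num) (by norm_num) (by norm_num)

/-- **M LINE — R-W ROWS `pilotDataOfK:frey-25916008300544-42234039306640625-42259955314941169:l` for EVERY prime `11 ≤ l ≤ 2091` with `l ≠ 251` —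
REFUTED side at the M setting, unconditionally, BY ONE BAND THEOREM** (M twin of `GenuineK.not_pilotKummerCompatHull_chosen_frey25916008300544_band`;
deciding place `u` over `p = 251`) (block F3 of the R-W numerics lead's WINDOW-TABLE: 72 tabulated Szpiro-bad admissible `l` of this triple, `11 ≤ l ≤
397`): triple `2 ^ 19 * 367 ^ 3 + 5 ^ 17 * 197 * 281 = 13 ^ 2 * 251 ^ 6`; deciding prime `p = 251` (`251^6 ∣ abc`, `p ∤ 30`), bands `B = 1` for `l ≤
2091` (certificate `l₀ = 11`); `l = 251` excluded (`p = l` is outside the decider): at the label `j = l⋆ = (l−1)/2` the [LIN]-uniform test of p464182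
holds throughout the band (quadratic certificate `LinUniformBand.test_of_cert`), so the hull-level clause S_H FAILS at the summand-route M-level sharp
setting of the OWN read-off ideles (pinned reading) of every genuine Θ-volume datum over `(ratPoint (a/c), l)` for every choice of the free context
binders and Kummer datum. NOT claimed: admissibility / Szpiro-badness / (P6) / non-emptiness. [cite: Mochizuki2012, IUTchIII Cor. 3.12 Step (xi-f) p.
184; IUTchIV Prop. 1.2 p. 10] [claim: Mochizuki2012, status: disputed] -/
theorem GenuineM.not_pilotKummerCompatHull_frey25916008300544_p251_band {l : ℕ} (hl : l.Prime) (hlo : 11 ≤ l) (hhi : l ≤ 2091) (hneP : l ≠ 251)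
    (T : Cor22.ThetaVolumeDatumAt (ratPoint (((2 ^ 19 * 367 ^ 3 : ℕ) : ℚ) / (13 ^ 2 * 251 ^ 6 : ℕ))) l) (u : FinitePlace ℚ) (hu : ratChar u = 251) :
    letI := T.instFieldF; letI := T.instNumberFieldF; letI := T.instAlgebraF; letI := T.instFieldK
    letI := T.instNumberFieldK; letI := T.instAlgebraK; letI := T.instFieldFbar; letI := T.instAlgebraFbar
    letI := T.instAlgebraKFbar; letI := T.instIsElliptic
    ∀ (M : Type) [Field M] [NumberField M]
      (archPk : ∀ (j : (thetaIndexOfInitial T.D).Label) (vQ : (thetaIndexOfInitial T.D).VQ),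
        Set ((logShellsOfInitialDH T.D (analyticLogvVal T.K)).Packet j vQ))
      (archSub : ∀ (j : (thetaIndexOfInitial T.D).Label) (v : (thetaIndexOfInitial T.D).V),
        Set ((logShellsOfInitialDH T.D (analyticLogvVal T.K)).Packet j ((thetaIndexOfInitial T.D).over v)))
      (Ψ : ℤ → ∀ v : (thetaIndexOfInitial T.D).V, v ∈ (thetaIndexOfInitial T.D).Vbad →
        Set ((logShellsOfInitialDH T.D (analyticLogvVal T.K)).StarPacket v))
      (act : ℤ → ∀ v : (thetaIndexOfInitial T.D).V, v ∈ (thetaIndexOfInitial T.D).Vbad →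
        (logShellsOfInitialDH T.D (analyticLogvVal T.K)).StarPacket v →
          Module.End ℚ ((logShellsOfInitialDH T.D (analyticLogvVal T.K)).StarPacket v))
      (Mmod : ℤ → ∀ j : (thetaIndexOfInitial T.D).LabelStar, Set ((logShellsOfInitialDH T.D (analyticLogvVal T.K)).GlobalPacket j.1))
      (region : ℤ → ∀ j : (thetaIndexOfInitial T.D).LabelStar, FinDivisor M → ∀ vQ : (thetaIndexOfInitial T.D).VQ,
        Set ((logShellsOfInitialDH T.D (analyticLogvVal T.K)).Packet j.1 vQ))
      (frobAdm : ℤ → ℤ → ∀ (j : (thetaIndexOfInitial T.D).Label) (vQ : (thetaIndexOfInitial T.D).VQ),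
        Set ((logShellsOfInitialDH T.D (analyticLogvVal T.K)).Packet j vQ) → Prop)
      (frobLogvol : ℤ → ℤ → ∀ (j : (thetaIndexOfInitial T.D).Label) (vQ : (thetaIndexOfInitial T.D).VQ),
        Set ((logShellsOfInitialDH T.D (analyticLogvVal T.K)).Packet j vQ) → ℝ)
      (frobΨ : ℤ → ℤ → ∀ v : (thetaIndexOfInitial T.D).V, v ∈ (thetaIndexOfInitial T.D).Vbad →
        Set ((logShellsOfInitialDH T.D (analyticLogvVal T.K)).StarPacket v))
      (frobMmod : ℤ → ℤ → ∀ j : (thetaIndexOfInitial T.D).LabelStar, Set ((logShellsOfInitialDH T.D (analyticLogvVal T.K)).GlobalPacket j.1))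
      (unitImage : ℤ → ℤ → ℕ → ∀ (j : (thetaIndexOfInitial T.D).Label) (vQ : (thetaIndexOfInitial T.D).VQ),
        Set ((logShellsOfInitialDH T.D (analyticLogvVal T.K)).Packet j vQ))
      (ballImage : ℤ → ℤ → ∀ (j : (thetaIndexOfInitial T.D).Label) (vQ : (thetaIndexOfInitial T.D).VQ),
        Set ((logShellsOfInitialDH T.D (analyticLogvVal T.K)).Packet j vQ))
      (thetaDiv : ℤ → ℤ → LgpDivisor M (thetaIndexOfInitial T.D).lstar)
      (n : ℤ) {HT : Type} {LogLink : HT → HT → Type} {IsFull : ∀ {s t : HT}, LogLink s t → Prop}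
      (lat : LGPGaussianLogThetaLattice LogLink IsFull)
      {Frd : Type} {IsoF : Frd → Frd → Type} {Ob : Frd → Type} {realify : Frd → Frd} {Strip : Type}
      {IsoS : Strip → Strip → Type} {Mv : ∀ v : (thetaIndexOfInitial T.D).V, v ∈ (thetaIndexOfInitial T.D).Vbad → Type}
      [∀ v h, Monoid (Mv v h)]
      (sig : GlobalLGPFrobenioidSignature (thetaIndexOfInitial T.D).lstar (thetaIndexOfInitial T.D).V
        (· ∈ (thetaIndexOfInitial T.D).Vbad) Frd IsoF Ob realify Strip IsoS Mv)
      (split : SplittingMonoids Mv) {ObΔ : Type} {N : ∀ v : (thetaIndexOfInitial T.D).V, v ∈ (thetaIndexOfInitial T.D).Vbad → Type}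
      [∀ v h, Monoid (N v h)] (qData : QPilotData ObΔ N)
      (qK : ∀ v : (thetaIndexOfInitial T.D).V, v ∈ (thetaIndexOfInitial T.D).Vbad →
        Set ((logShellsOfInitialDH T.D (analyticLogvVal T.K)).StarPacket v)),
      ¬ Cor312Vol.PilotKummerCompatHull
        (LatticeSituation.ofShells (logShellsOfInitialDH T.D (analyticLogvVal T.K)) M archPk archSub
          (summandPiecesPrM T.D (logvAnalyticVal_analyticLogvVal (K := T.K))).Adm (summandPiecesPrM T.D (logvAnalyticVal_analyticLogvVal (K := T.K))).logvol Ψ act Mmod region frobAdm frobLogvol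
          frobΨ frobMmod unitImage ballImage thetaDiv)
        (settingPrVolSharpM T.D (logvAnalyticVal_analyticLogvVal (K := T.K)) (tOfIdeleData T.D (ideleDataOf T.D T.isVolumeInputOf))
          (fun u x => tqM T.D (ratChar u) u (natCast_ratChar_mem u) (ideleDataOf T.D T.isVolumeInputOf) x) M archPk archSub Ψ act Mmod region n lat sig split qData
          (fun u x => tqM_ne_zero T.D (ratChar u) u (natCast_ratChar_mem u) (ideleDataOf T.D T.isVolumeInputOf) x)
          (GenuineM.finite_ratPlaces_under_S T.D).toFinset
          (fun u x hu => norm_tqM_eq_one_of_not_mem T.D (ratChar u) u (natCast_ratChar_mem u) (ideleDataOf T.D T.isVolumeInputOf) x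
            fun hx => hu ((Set.Finite.mem_toFinset _).mpr ⟨x, hx⟩)))
        (fun _ => Cor312.Setting.qRegion
          (settingPrVolSharpM T.D (logvAnalyticVal_analyticLogvVal (K := T.K)) (tOfIdeleData T.D (ideleDataOf T.D T.isVolumeInputOf))
          (fun u x => tqM T.D (ratChar u) u (natCast_ratChar_mem u) (ideleDataOf T.D T.isVolumeInputOf) x) M archPk archSub Ψ act Mmod region n lat sig split qData
          (fun u x => tqM_ne_zero T.D (ratChar u) u (natCast_ratChar_mem u) (ideleDataOf T.D T.isVolumeInputOf) x)
          (GenuineM.finite_ratPlaces_under_S T.D).toFinset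
          (fun u x hu => norm_tqM_eq_one_of_not_mem T.D (ratChar u) u (natCast_ratChar_mem u) (ideleDataOf T.D T.isVolumeInputOf) x
            fun hx => hu ((Set.Finite.mem_toFinset _).mpr ⟨x, hx⟩)))) qK := by
  exact GenuineM.not_pilotKummerCompatHull_triple_of_linUniform_cert isABCTriple_367251 T u 251 hu (by norm_num) (by norm_num)
      (by norm_num) hneP.symm 1 (by show 30 * l < 251 ^ 1 * (251 - 1); norm_num; omega) 6 (by norm_num) (dvd_mul_of_dvd_right (by norm_num) _) hl (by omega) 11 (by omega)
      (by norm_num) (by norm_num) (by norm_num)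

end Summit.ABC.IUTFork.Conditional

end
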